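import Summits.ValiantsHypothesis.ValiantsHypothesis.Theorems.TwoProducts.RankThreeAffineToricWronskianCone
import Summits.ValiantsHypothesis.ValiantsHypothesis.Theorems.TwoProducts.RankThreeAffineToricWronskianDepth

/-!
# Toric Wronskians of monomials, part 12: LEVEL EXTREMES — at most two cone tops per level, and the slab count (LV-1)

Sequel of ✓ `…ToricWronskianCone` (LV-3a: `coneTops`, p724481) and ✓ `…ToricWronskianDepth` (W4a: `toricW_support_layer`).  First CONTENT file toward
the one-vertex hypothesis shape `ConeTopBound` (✓ LV-3b): val-idea-crit-8 g6, merge memo rev C (C2)/(C5) LV-1 «every top of `W` is a LEVEL EXTREME, at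
most two per level».  For a non-zero lattice vector `w` the `w`-LEVEL of an exponent `P` is `det(w, P)`; a level is a line of direction `w`.
§1 along a level every chart weight is affine in the position `⟨w, ·⟩` with the same slope `(μw₀ + σw₁)/|w|²` (`wt_sub_eq_mul_pos_sub_of_level`); the
position separates the points of a level (`eq_of_level_of_pos_eq`); hence ★ `pos_extreme_of_isUniqueTop_level`: a point of a level that is the unique top
of `F` in some chart direction is a STRICT position-extreme among the support points of `F` on that level.
§2 ★★ `card_coneTops_filter_level_le_two`: for ANY `F`, carrier `u`, vertex `v`, `w ≠ 0` and level `c`, at most TWO cone tops of `F` lie on the level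
`det(w, ·) = c` (three extremes on one line are impossible); ★ `card_coneTops_le_two_mul_card_levels`: `|coneTops σ u v F| ≤ 2·#{det(w, P) : P ∈ supp F}`.
§3 for the toric Wronskian `W = W_{J(·,u)}(X^{e_0..e_{K−1}})` of a carrier inside the SLAB `|det(w, s)| ≤ M` (`s ∈ supp u`; letters ON the line `ℝw`
have level 0): ★ `levels_toricW_subset_of_slab` — the levels of `W` lie in `det(w, Σe_i) + [−N·M, N·M]`, `N = Σ_{i<K} i` (every support point is `Σe_i` +
an `N`-letter word, ✓ `toricW_support_layer`; `abs_multiset_sum_map_le`), so `≤ 2·N·M + 1` levels (`card_levels_toricW_le_of_slab`), and ★★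
`card_coneTops_toricW_le_of_slab`: `|coneTops σ u v W| ≤ 2·(2·N·M + 1)` at EVERY vertex `v`, for EVERY `t = |supp u|` and all degrees — a t-FREE count
(K-dependent through `N`, slab-dependent through `M`; in the OLM slot at a resonant vertex the merging letters live in a slab of height poly(m), memo (C2)).
HONEST SCOPE (val-idea-crit-8 g6 #128): this is the SLAB-CARRIER CELL — EVERY letter of `u` within transverse height `M` of the line `ℝw` (`M` is a
TRANSVERSE-HEIGHT bound, NOT a sparsity bound; take `w` primitive along the resonant vertex `v`); it is NOT `ConeTopBound R` for any `R` (that shape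
quantifies over ALL carriers).  Carriers with FAR letters (unbounded `|det(w, s)|` — in the `m = 1` box the heights go up to the degree) are OUTSIDE: their
mixed words of far and slab letters are LV-2's subject (memo (C2)/(D)), OPEN; progress on `R` itself = 0.
HONEST LABEL: located count / bookkeeping on the OPEN rung 3-AFF (side ladder, crux `stmt-ValiantsHypothesis-5906` `TwoProducts`); (TW-flag, poly) AT
MERGES = `ConeTopBound`-poly, `OLMLaw`, `RankThreeAffineLaw(Exp)`, `TwoProducts`, PCB, `ResidualLawV25` UNMOVED; 0 summit distance; VP ≠ VNP is NOT
proved; no summit statement is proved here.  `--supports stmt-ValiantsHypothesis-5906 --as helper` (val-port-4 g6; critic of record val-idea-crit-8 g6).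
No defs, no instances, no notation, no named facts. [folklore]
-/

noncomputable section
set_option linter.dupNamespace false

namespace Summit.ValiantsHypothesis.ValiantsHypothesis.Theorems.TwoProducts.RankTwoJacobian

open scoped BigOperators
open MvPolynomial
open Literature.LinearAlgebra.Matrix (wronskianMatrix wronskian wronskianMatrix_apply wronskian_def)

section TowerKernel
open scoped Classical

/-! ### §1 Levels: along a line of direction `w` every chart weight is affine in the position `⟨w, ·⟩` -/

/-- `idet` is additive in its second argument. [folklore] -/
theorem idet_add_right (w a b : Expo) : idet w (a + b) = idet w a + idet w b := by
  unfold idet; simp only [Finsupp.add_apply, Nat.cast_add]; ring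

/-- `idet w (Σ multiset) = Σ idet w ·`. [folklore] -/
theorem idet_multiset_sum (w : Expo) (m : Multiset Expo) : idet w m.sum = (m.map (idet w)).sum := by
  induction m using Multiset.induction_on with
  | empty => rw [Multiset.sum_zero, Multiset.map_zero, Multiset.sum_zero, idet_zero_right]
  | cons s m ih => rw [Multiset.sum_cons, Multiset.map_cons, Multiset.sum_cons, idet_add_right, ih]

/-- two points of one `w`-level (`det(w, P) = det(w, Q)`): the difference of their chart weights is `(μw₀ + σw₁)/|w|²` times the difference of their
positions `⟨w, ·⟩`. [folklore] -/
theorem wt_sub_eq_mul_pos_sub_of_level (w : Expo) (σ μ : ℝ) {P Q : Expo} (h : idet w P = idet w Q) :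
    ((((w 0 : ℕ) : ℝ)) ^ 2 + ((w 1 : ℕ) : ℝ) ^ 2) * (wt (dir σ μ) P - wt (dir σ μ) Q) =
      (μ * (w 0 : ℕ) + σ * (w 1 : ℕ)) *
        ((((w 0 : ℕ) : ℝ) * (P 0 : ℕ) + ((w 1 : ℕ) : ℝ) * (P 1 : ℕ)) - (((w 0 : ℕ) : ℝ) * (Q 0 : ℕ) + ((w 1 : ℕ) : ℝ) * (Q 1 : ℕ))) := by
  have hl : ((w 0 : ℕ) : ℝ) * ((P 1 : ℕ) - (Q 1 : ℕ)) = ((w 1 : ℕ) : ℝ) * ((P 0 : ℕ) - (Q 0 : ℕ)) := by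
    unfold idet at h
    have h' : ((w 0 : ℕ) : ℤ) * (P 1 : ℕ) - ((w 1 : ℕ) : ℤ) * (P 0 : ℕ) = ((w 0 : ℕ) : ℤ) * (Q 1 : ℕ) - ((w 1 : ℕ) : ℤ) * (Q 0 : ℕ) := h
    have := congrArg (fun z : ℤ => (z : ℝ)) h'
    push_cast at this
    linarith
  rw [wt_dir, wt_dir]
  linear_combination (σ * ((w 0 : ℕ) : ℝ) - μ * ((w 1 : ℕ) : ℝ)) * hl

/-- on one `w`-level (`w ≠ 0`) the position `⟨w, ·⟩` separates points. [folklore] -/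
theorem eq_of_level_of_pos_eq {w : Expo} (hw : w ≠ 0) {P Q : Expo} (h : idet w P = idet w Q)
    (hξ : ((w 0 : ℕ) : ℤ) * (P 0 : ℕ) + ((w 1 : ℕ) : ℤ) * (P 1 : ℕ) = ((w 0 : ℕ) : ℤ) * (Q 0 : ℕ) + ((w 1 : ℕ) : ℤ) * (Q 1 : ℕ)) : P = Q := by
  set a : ℤ := ((P 0 : ℕ) : ℤ) - (Q 0 : ℕ) with ha
  set b : ℤ := ((P 1 : ℕ) : ℤ) - (Q 1 : ℕ) with hb
  have h1 : ((w 0 : ℕ) : ℤ) * a + ((w 1 : ℕ) : ℤ) * b = 0 := by rw [ha, hb]; linear_combination hξ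
  have h2 : ((w 0 : ℕ) : ℤ) * b = ((w 1 : ℕ) : ℤ) * a := by
    unfold idet at h; rw [ha, hb]; linear_combination h
  have hD : ((w 0 : ℕ) : ℤ) ^ 2 + ((w 1 : ℕ) : ℤ) ^ 2 ≠ 0 := by
    intro h0
    have h00 : ((w 0 : ℕ) : ℤ) = 0 := by nlinarith
    have h11 : ((w 1 : ℕ) : ℤ) = 0 := by nlinarith
    exact hw (expo_eq_of_coords (by exact_mod_cast h00) (by exact_mod_cast h11))
  have ha0 : (((w 0 : ℕ) : ℤ) ^ 2 + ((w 1 : ℕ) : ℤ) ^ 2) * a = 0 := by linear_combination ((w 0 : ℕ) : ℤ) * h1 - ((w 1 : ℕ) : ℤ) * h2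
  have hb0 : (((w 0 : ℕ) : ℤ) ^ 2 + ((w 1 : ℕ) : ℤ) ^ 2) * b = 0 := by linear_combination ((w 1 : ℕ) : ℤ) * h1 + ((w 0 : ℕ) : ℤ) * h2
  have ha' : a = 0 := (mul_eq_zero.mp ha0).resolve_left hD
  have hb' : b = 0 := (mul_eq_zero.mp hb0).resolve_left hD
  refine expo_eq_of_coords ?_ ?_
  · have : ((P 0 : ℕ) : ℤ) = (Q 0 : ℕ) := by rw [ha] at ha'; linarith
    exact_mod_cast this
  · have : ((P 1 : ℕ) : ℤ) = (Q 1 : ℕ) := by rw [hb] at hb'; linarith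
    exact_mod_cast this

/-- ★ a point of a `w`-level that is the unique top of `F` in some chart direction is a STRICT EXTREME of the position `⟨w, ·⟩` among the support points
of `F` on that level. [folklore] -/
theorem pos_extreme_of_isUniqueTop_level {w : Expo} (hw : w ≠ 0) {σ μ : ℝ} {F : Poly2} {P : Expo} (hP : IsUniqueTop (dir σ μ) F P) :
    (∀ Q ∈ F.support, Q ≠ P → idet w Q = idet w P →
      ((w 0 : ℕ) : ℤ) * (Q 0 : ℕ) + ((w 1 : ℕ) : ℤ) * (Q 1 : ℕ) < ((w 0 : ℕ) : ℤ) * (P 0 : ℕ) + ((w 1 : ℕ) : ℤ) * (P 1 : ℕ)) ∨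
    (∀ Q ∈ F.support, Q ≠ P → idet w Q = idet w P →
      ((w 0 : ℕ) : ℤ) * (P 0 : ℕ) + ((w 1 : ℕ) : ℤ) * (P 1 : ℕ) < ((w 0 : ℕ) : ℤ) * (Q 0 : ℕ) + ((w 1 : ℕ) : ℤ) * (Q 1 : ℕ)) := by
  set c : ℝ := μ * (w 0 : ℕ) + σ * (w 1 : ℕ) with hc
  set N2 : ℝ := (((w 0 : ℕ) : ℝ)) ^ 2 + ((w 1 : ℕ) : ℝ) ^ 2 with hN2
  have hN2pos : 0 < N2 := by
    rw [hN2]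
    by_contra h0
    have h0' : (((w 0 : ℕ) : ℝ)) ^ 2 + ((w 1 : ℕ) : ℝ) ^ 2 = 0 := le_antisymm (not_lt.mp h0) (by positivity)
    have h00 : ((w 0 : ℕ) : ℝ) = 0 := by nlinarith
    have h11 : ((w 1 : ℕ) : ℝ) = 0 := by nlinarith
    exact hw (expo_eq_of_coords (by exact_mod_cast h00) (by exact_mod_cast h11))
  have key : ∀ Q ∈ F.support, Q ≠ P → idet w Q = idet w P →
      c * (((w 0 : ℕ) : ℝ) * (Q 0 : ℕ) + ((w 1 : ℕ) : ℝ) * (Q 1 : ℕ)) < c * (((w 0 : ℕ) : ℝ) * (P 0 : ℕ) + ((w 1 : ℕ) : ℝ) * (P 1 : ℕ)) := by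
    intro Q hQ hQP hlev
    have hlt := hP.2 Q hQ hQP
    have h1 := wt_sub_eq_mul_pos_sub_of_level w σ μ hlev.symm
    rw [← hN2, ← hc] at h1
    nlinarith
  rcases lt_trichotomy c 0 with hc0 | hc0 | hc0
  · right
    intro Q hQ hQP hlev
    have h := key Q hQ hQP hlev
    have h' : (((w 0 : ℕ) : ℝ) * (P 0 : ℕ) + ((w 1 : ℕ) : ℝ) * (P 1 : ℕ)) < (((w 0 : ℕ) : ℝ) * (Q 0 : ℕ) + ((w 1 : ℕ) : ℝ) * (Q 1 : ℕ)) := by nlinarith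
    have h'' : (((((w 0 : ℕ) : ℤ) * (P 0 : ℕ) + ((w 1 : ℕ) : ℤ) * (P 1 : ℕ) : ℤ)) : ℝ) <
        (((((w 0 : ℕ) : ℤ) * (Q 0 : ℕ) + ((w 1 : ℕ) : ℤ) * (Q 1 : ℕ) : ℤ)) : ℝ) := by push_cast; exact h'
    exact_mod_cast h''
  · left
    intro Q hQ hQP hlev
    have h := key Q hQ hQP hlev
    rw [hc0, zero_mul, zero_mul] at h
    exact absurd h (lt_irrefl _)
  · left
    intro Q hQ hQP hlev
    have h := key Q hQ hQP hlev
    have h' : (((w 0 : ℕ) : ℝ) * (Q 0 : ℕ) + ((w 1 : ℕ) : ℝ) * (Q 1 : ℕ)) < (((w 0 : ℕ) : ℝ) * (P 0 : ℕ) + ((w 1 : ℕ) : ℝ) * (P 1 : ℕ)) := by nlinarith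
    have h'' : (((((w 0 : ℕ) : ℤ) * (Q 0 : ℕ) + ((w 1 : ℕ) : ℤ) * (Q 1 : ℕ) : ℤ)) : ℝ) <
        (((((w 0 : ℕ) : ℤ) * (P 0 : ℕ) + ((w 1 : ℕ) : ℤ) * (P 1 : ℕ) : ℤ)) : ℝ) := by push_cast; exact h'
    exact_mod_cast h''

/-! ### §2 At most two cone tops per level; cone tops ≤ 2 · levels -/

/-- ★★ **AT MOST TWO CONE TOPS PER LEVEL:** for `w ≠ 0` and any level `c`, at most two cone tops of `F` (at any vertex `v` of any carrier `u`) satisfy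
`det(w, P) = c` — every cone top is a unique top in some direction, hence a strict position-extreme of its level, and three points of one level cannot
all be extremes. [folklore] -/
theorem card_coneTops_filter_level_le_two (σ : ℝ) (u : Poly2) (v : Expo) (F : Poly2) {w : Expo} (hw : w ≠ 0) (c : ℤ) :
    ((coneTops σ u v F).filter fun P => idet w P = c).card ≤ 2 := by
  by_contra h3
  obtain ⟨x, y, z, hx, hy, hz, hxy, hxz, hyz⟩ := Finset.two_lt_card_iff.mp (not_le.mp h3)
  obtain ⟨hx', hlx⟩ := Finset.mem_filter.mp hx
  obtain ⟨hy', hly⟩ := Finset.mem_filter.mp hy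
  obtain ⟨hz', hlz⟩ := Finset.mem_filter.mp hz
  obtain ⟨hxs, μx, -, -, hμx⟩ := Finset.mem_filter.mp hx'
  obtain ⟨hys, μy, -, -, hμy⟩ := Finset.mem_filter.mp hy'
  obtain ⟨hzs, μz, -, -, hμz⟩ := Finset.mem_filter.mp hz'
  have ex := pos_extreme_of_isUniqueTop_level hw hμx
  have ey := pos_extreme_of_isUniqueTop_level hw hμy
  have ez := pos_extreme_of_isUniqueTop_level hw hμz
  have lxy : idet w y = idet w x := hly.trans hlx.symm
  have lxz : idet w z = idet w x := hlz.trans hlx.symm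
  have lyz : idet w z = idet w y := hlz.trans hly.symm
  rcases ex with hx'' | hx'' <;> rcases ey with hy'' | hy'' <;> rcases ez with hz'' | hz'' <;>
    first
      | exact absurd (hx'' y hys (Ne.symm hxy) lxy) (not_lt.mpr (le_of_lt (hy'' x hxs hxy lxy.symm)))
      | exact absurd (hx'' z hzs (Ne.symm hxz) lxz) (not_lt.mpr (le_of_lt (hz'' x hxs hxz lxz.symm)))
      | exact absurd (hy'' z hzs (Ne.symm hyz) lyz) (not_lt.mpr (le_of_lt (hz'' y hys hyz lyz.symm)))

/-- ★ **CONE TOPS ≤ 2 · LEVELS:** `|coneTops σ u v F| ≤ 2 · #{det(w, P) : P ∈ supp F}` for every `w ≠ 0`. -/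
theorem card_coneTops_le_two_mul_card_levels (σ : ℝ) (u : Poly2) (v : Expo) (F : Poly2) {w : Expo} (hw : w ≠ 0) :
    (coneTops σ u v F).card ≤ 2 * (F.support.image (idet w)).card := by
  have h1 : (coneTops σ u v F).card ≤ 2 * ((coneTops σ u v F).image (idet w)).card :=
    Finset.card_le_mul_card_image _ 2 fun c _ => card_coneTops_filter_level_le_two σ u v F hw c
  have h2 : ((coneTops σ u v F).image (idet w)).card ≤ (F.support.image (idet w)).card :=
    Finset.card_le_card (Finset.image_subset_image (Finset.filter_subset _ _))
  omega

/-! ### §3 The levels of a toric Wronskian inside a slab -/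

/-- a sum of `n` integers of absolute value `≤ M` has absolute value `≤ n·M`. [folklore] -/
theorem abs_multiset_sum_map_le {m : Multiset Expo} {f : Expo → ℤ} {M : ℕ} (h : ∀ s ∈ m, |f s| ≤ M) :
    |(m.map f).sum| ≤ (Multiset.card m : ℤ) * M := by
  induction m using Multiset.induction_on with
  | empty => simp
  | cons s m ih =>
    have hs : |f s| ≤ M := h s (Multiset.mem_cons_self s m)
    have ih' := ih (fun s' hs' => h s' (Multiset.mem_cons_of_mem hs'))
    rw [Multiset.map_cons, Multiset.sum_cons, Multiset.card_cons]
    push_cast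
    calc |f s + (m.map f).sum| ≤ |f s| + |(m.map f).sum| := abs_add_le _ _
      _ ≤ (M : ℤ) + (Multiset.card m : ℤ) * M := add_le_add hs ih'
      _ = ((Multiset.card m : ℤ) + 1) * M := by ring

/-- ★ THE LEVELS OF `W`: if every support point `s` of `u` has `|det(w, s)| ≤ M` (a SLAB of height `M` around the line `ℝw`; letters on the line have
level `0`), then the `w`-levels of `W_{J(·,u)}(X^{e_0..e_{K−1}})` lie in the window `det(w, Σe_i) + [−N·M, N·M]`, `N = Σ_{i<K} i` — every support point of
`W` is `Σe_i` plus an `N`-letter word over `supp u` (✓ `toricW_support_layer`). -/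
theorem levels_toricW_subset_of_slab (u : Poly2) {K : ℕ} (e : Fin K → Expo) (w : Expo) {M : ℕ} (hM : ∀ s ∈ u.support, |idet w s| ≤ M) :
    (wronskian (⇑(jacDer u)) (fun i => monomial (e i) (1 : ℂ))).support.image (idet w) ⊆
      Finset.Icc (idet w (∑ i, e i) - ((∑ i : Fin K, (i : ℕ)) * M : ℕ)) (idet w (∑ i, e i) + ((∑ i : Fin K, (i : ℕ)) * M : ℕ)) := by
  intro c hc
  obtain ⟨z, hz, rfl⟩ := Finset.mem_image.mp hc
  obtain ⟨m, hm, hcard, -, rfl⟩ := toricW_support_layer u 0 e e (fun _ => 0) (fun i => by rw [zero_smul, add_zero]) hz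
  rw [idet_add_right, idet_multiset_sum]
  have hb := abs_multiset_sum_map_le (f := idet w) fun s hs => hM s (hm s hs)
  rw [hcard] at hb
  push_cast at hb
  rw [Finset.mem_Icc]
  push_cast
  constructor
  · linarith [neg_abs_le (m.map (idet w)).sum]
  · linarith [le_abs_self (m.map (idet w)).sum]

/-- hence at most `2·N·M + 1` levels. [folklore] -/
theorem card_levels_toricW_le_of_slab (u : Poly2) {K : ℕ} (e : Fin K → Expo) (w : Expo) {M : ℕ} (hM : ∀ s ∈ u.support, |idet w s| ≤ M) :
    ((wronskian (⇑(jacDer u)) (fun i => monomial (e i) (1 : ℂ))).support.image (idet w)).card ≤ 2 * ((∑ i : Fin K, (i : ℕ)) * M) + 1 := by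
  refine (Finset.card_le_card (levels_toricW_subset_of_slab u e w hM)).trans ?_
  rw [Int.card_Icc]
  have : idet w (∑ i, e i) + ((∑ i : Fin K, (i : ℕ)) * M : ℕ) + 1 - (idet w (∑ i, e i) - ((∑ i : Fin K, (i : ℕ)) * M : ℕ)) =
      ((2 * ((∑ i : Fin K, (i : ℕ)) * M) + 1 : ℕ) : ℤ) := by push_cast; ring
  rw [this, Int.toNat_natCast]

/-- ★★ **(LV-1) THE SLAB COUNT — t-FREE:** at ANY vertex `v` of ANY carrier `u` inside the slab `|det(w, s)| ≤ M` (`w ≠ 0`; e.g. `w` the primitive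
vector of `v`, the letters ON the resonance ray having level `0`), the toric Wronskian of `K` monomial columns has at most `2·(2·N·M + 1)` cone tops,
`N = Σ_{i<K} i` — independently of `t = |supp u|` and of all degrees (val-idea-crit-8 g6, memo rev C (C2)/(C5) LV-1: «every top is a level extreme,
≤ 2 per level»).  REMARKS: `M` bounds the transverse height `|det(w, s)|` of EVERY support point — a slab condition, not sparsity; carriers with far
letters are not covered (LV-2); this is not `ConeTopBound R` for any `R`. -/
theorem card_coneTops_toricW_le_of_slab (σ : ℝ) (u : Poly2) (v : Expo) {K : ℕ} (e : Fin K → Expo) {w : Expo} (hw : w ≠ 0) {M : ℕ}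
    (hM : ∀ s ∈ u.support, |idet w s| ≤ M) :
    (coneTops σ u v (wronskian (⇑(jacDer u)) (fun i => monomial (e i) (1 : ℂ)))).card ≤ 2 * (2 * ((∑ i : Fin K, (i : ℕ)) * M) + 1) :=
  (card_coneTops_le_two_mul_card_levels σ u v _ hw).trans (Nat.mul_le_mul_left 2 (card_levels_toricW_le_of_slab u e w hM))

end TowerKernel

end Summit.ValiantsHypothesis.ValiantsHypothesis.Theorems.TwoProducts.RankTwoJacobian

end
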